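import Summits.Ventures.QEC.Decoders.RadiusCheck
import Summits.Ventures.QEC.Decoders.ToricL3MWPM
import HarnessLib

/-!
# Ventures/QEC — Decoders/RadiusCheckChunked: chunked radius checks and the identity-residual route
# (continuation of `Decoders/RadiusCheck.lean`, qec PARTITION row 08; kept separate for the 400-line cap)

HONEST FRAMING: CERTIFIED column only; nothing probabilistic. Same vocabulary as `RadiusCheck.lean`
(`tableDecoder`, `leafT` / `checkRadiusT`, `leafE` / `checkRadiusE`) and the certificate checker's
replay calculus (`Census.Reaches`, `Census.reaches_of_scan`, `Census.reaches_of_chunks` of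
`Census/CertScan.lean`).

* `Reaches`-level soundness: `boundedDistance_of_reachesT` (route T), `residual_mem_of_reachesE`
  (route E) — what ANY complete replay of the weight-`≤ t` ball establishes, however it was computed;
* CHUNKS keyed by the smallest qubit of the support (CERT-FORMAT §7 chunk key, as for the distance
  lower bound): `radiusChunkT n Hsyn T t b i` / `radiusChunkE …`; assembling theorems
  `reachesT_of_chunks`, `reachesE_of_chunks` (the empty word is its own chunk `leaf… 0 0`), and the
  `CorrectsUpTo` corollaries `correctsUpToX/Z_of_radiusChunksT/E` — so a radius certificate of a
  72-qubit code splits into `n` LIGHT `decide` files exactly like a distance certificate;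
* ROUTE I (identity residual): `leafI` / `checkRadiusI` / `radiusChunkI` — the table answer IS the
  error (`T(s) = e`; the nondegenerate regime `2t < d`, e.g. BP+OSD on `[[72,12,6]]` at `t = 2` where
  every residual certificate is empty): no `E` list and no distance needed,
  `correctsUpToX/Z_of_checkRadiusI`, `…_of_radiusChunksI`.
-/

namespace Summit.Ventures.QEC.Decoders

open Matrix Literature.InformationTheory.QuantumCodes

/-! ## Route T from a complete replay; chunks -/

/-- **Route T from any complete replay**: if `leafT` was reached on every support of weight `≤ t`
(`Census.Reaches`), then on every error of weight `≤ t` the table answer has the error's syndrome and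
weight `≤ t`. -/
theorem boundedDistance_of_reachesT {n : ℕ} {Hsyn : List ℕ} {T : List (ℕ × ℕ)} {t : ℕ}
    (h : Census.Reaches (leafT n Hsyn T t) (Census.posList n Hsyn) t 0 0) (e : Fin n → ZMod 2)
    (he : hammingNorm e ≤ t) :
    Census.rowMatrix n Hsyn *ᵥ tableDecoder n Hsyn.length T (Census.rowMatrix n Hsyn *ᵥ e) =
        Census.rowMatrix n Hsyn *ᵥ e ∧
      hammingNorm (tableDecoder n Hsyn.length T (Census.rowMatrix n Hsyn *ᵥ e)) ≤ t := by
  have hS := h (Census.suppList n Hsyn e) (Census.suppList_sublist n Hsyn e)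
    (by rw [Census.length_suppList]; exact he)
  rw [Nat.zero_xor, Nat.zero_xor, leafT, Bool.and_eq_true, beq_iff_eq, Nat.ble_eq] at hS
  obtain ⟨hsyn, hwt⟩ := hS
  rw [tableDecoder_mulVec]
  refine ⟨?_, by rw [Census.hammingNorm_ofBits]; exact hwt⟩
  rw [← ofBits_synWordOf, hsyn, Census.ofBits_xorSnd_suppList]

/-- Chunk `i` of the route-T replay with total budget `b + 1`: the supports whose smallest qubit is `i`
(scan of budget `b` over the qubits after `i`, starting from qubit `i`'s word and syndrome column). -/
def radiusChunkT (n : ℕ) (Hsyn : List ℕ) (T : List (ℕ × ℕ)) (t b i : ℕ) : Bool :=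
  Census.scan (leafT n Hsyn T t) ((Census.posList n Hsyn).drop (i + 1)) b (2 ^ i)
    (Census.colMask Hsyn i)

/-- **Assembling the route-T chunks**: the empty-word leaf plus the `n` first-index chunks of budget
`b` give the complete replay of budget `b + 1`. -/
theorem reachesT_of_chunks {n : ℕ} {Hsyn : List ℕ} {T : List (ℕ × ℕ)} {t b : ℕ}
    (h0 : leafT n Hsyn T t 0 0 = true) (h : ∀ i : ℕ, i < n → radiusChunkT n Hsyn T t b i = true) :
    Census.Reaches (leafT n Hsyn T t) (Census.posList n Hsyn) (b + 1) 0 0 := by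
  refine Census.reaches_of_chunks _ b 0 0 h0 fun i hi => ?_
  have hin : i < n := by simpa [Census.posList] using hi
  have hget : (Census.posList n Hsyn)[i] = (2 ^ i, Census.colMask Hsyn i) := by simp [Census.posList]
  rw [hget, Nat.zero_xor, Nat.zero_xor]
  exact Census.reaches_of_scan (h i hin)

/-- **Route T, chunked, `X`-sector**: empty-word leaf + all chunks of budget `t − 1`… stated with
`t = b + 1`: chunks of budget `b`, claimed radius `b + 1`, and `2(b+1) < d^X`. -/
theorem correctsUpToX_of_radiusChunksT {n : ℕ} {HX HZ : List ℕ}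
    (hcomm : Census.rowMatrix n HX * (Census.rowMatrix n HZ)ᵀ = 0) {T : List (ℕ × ℕ)} {b : ℕ}
    (h0 : leafT n HZ T (b + 1) 0 0 = true)
    (h : ∀ i : ℕ, i < n → radiusChunkT n HZ T (b + 1) b i = true)
    (hd : 2 * (b + 1) < (CSSCode.ofMatrices (Census.rowMatrix n HX) (Census.rowMatrix n HZ) hcomm).dX) :
    (tableDecoder n HZ.length T).CorrectsUpTo
      (CSSCode.ofMatrices (Census.rowMatrix n HX) (Census.rowMatrix n HZ) hcomm).xSyndrome
      ((CSSCode.ofMatrices (Census.rowMatrix n HX) (Census.rowMatrix n HZ) hcomm).rowSpX :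
        Set (Fin n → ZMod 2)) hammingNorm (b + 1) :=
  have hr := reachesT_of_chunks h0 h
  CSSCode.correctsUpToX_of_boundedDistance _ (fun e he => (boundedDistance_of_reachesT hr e he).1)
    (fun e he => (boundedDistance_of_reachesT hr e he).2) hd

/-- **Route T, chunked, `Z`-sector** (rows exchanged). -/
theorem correctsUpToZ_of_radiusChunksT {n : ℕ} {HX HZ : List ℕ}
    (hcomm : Census.rowMatrix n HX * (Census.rowMatrix n HZ)ᵀ = 0) {T : List (ℕ × ℕ)} {b : ℕ}
    (h0 : leafT n HX T (b + 1) 0 0 = true)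
    (h : ∀ i : ℕ, i < n → radiusChunkT n HX T (b + 1) b i = true)
    (hd : 2 * (b + 1) < (CSSCode.ofMatrices (Census.rowMatrix n HX) (Census.rowMatrix n HZ) hcomm).dZ) :
    (tableDecoder n HX.length T).CorrectsUpTo
      (CSSCode.ofMatrices (Census.rowMatrix n HX) (Census.rowMatrix n HZ) hcomm).zSyndrome
      ((CSSCode.ofMatrices (Census.rowMatrix n HX) (Census.rowMatrix n HZ) hcomm).rowSpZ :
        Set (Fin n → ZMod 2)) hammingNorm (b + 1) :=
  correctsUpToX_of_radiusChunksT
    (CSSCode.ofMatrices (Census.rowMatrix n HX) (Census.rowMatrix n HZ) hcomm).swap.comm h0 h hd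

/-! ## Route E from a complete replay; chunks -/

/-- **Route E from any complete replay**: the residual of every error of weight `≤ t` lies in the row
space of the stabilizer rows. -/
theorem residual_mem_of_reachesE {n : ℕ} {Hsyn Hstab : List ℕ} {T : List (ℕ × ℕ)}
    {E : List (ℕ × List ℕ)} {t : ℕ}
    (h : Census.Reaches (leafE n Hstab T E) (Census.posList n Hsyn) t 0 0) (e : Fin n → ZMod 2)
    (he : hammingNorm e ≤ t) :
    tableDecoder n Hsyn.length T (Census.rowMatrix n Hsyn *ᵥ e) + e ∈
      rowSpace (Census.rowMatrix n Hstab) := by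
  have hS := h (Census.suppList n Hsyn e) (Census.suppList_sublist n Hsyn e)
    (by rw [Census.length_suppList]; exact he)
  rw [Nat.zero_xor, Nat.zero_xor, leafE] at hS
  cases hl : E.lookup (Census.xorFst (Census.suppList n Hsyn e)) with
  | none => rw [hl] at hS; exact Bool.noConfusion hS
  | some sel =>
    rw [hl] at hS
    simp only [Bool.and_eq_true, beq_iff_eq, decide_eq_true_eq] at hS
    have key := Census.ofBits_xorRows_mem_rowSpace n Hstab sel
    rw [hS.1, Census.ofBits_xor, Census.ofBits_xorFst_suppList] at key
    rw [tableDecoder_mulVec]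
    exact key

/-- Chunk `i` of the route-E replay with total budget `b + 1`. -/
def radiusChunkE (n : ℕ) (Hsyn Hstab : List ℕ) (T : List (ℕ × ℕ)) (E : List (ℕ × List ℕ))
    (b i : ℕ) : Bool :=
  Census.scan (leafE n Hstab T E) ((Census.posList n Hsyn).drop (i + 1)) b (2 ^ i)
    (Census.colMask Hsyn i)

/-- **Assembling the route-E chunks.** -/
theorem reachesE_of_chunks {n : ℕ} {Hsyn Hstab : List ℕ} {T : List (ℕ × ℕ)} {E : List (ℕ × List ℕ)}
    {b : ℕ} (h0 : leafE n Hstab T E 0 0 = true)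
    (h : ∀ i : ℕ, i < n → radiusChunkE n Hsyn Hstab T E b i = true) :
    Census.Reaches (leafE n Hstab T E) (Census.posList n Hsyn) (b + 1) 0 0 := by
  refine Census.reaches_of_chunks _ b 0 0 h0 fun i hi => ?_
  have hin : i < n := by simpa [Census.posList] using hi
  have hget : (Census.posList n Hsyn)[i] = (2 ^ i, Census.colMask Hsyn i) := by simp [Census.posList]
  rw [hget, Nat.zero_xor, Nat.zero_xor]
  exact Census.reaches_of_scan (h i hin)

/-- **Route E, chunked, `X`-sector** (no distance hypothesis). -/
theorem correctsUpToX_of_radiusChunksE {n : ℕ} {HX HZ : List ℕ}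
    (hcomm : Census.rowMatrix n HX * (Census.rowMatrix n HZ)ᵀ = 0) {T : List (ℕ × ℕ)}
    {E : List (ℕ × List ℕ)} {b : ℕ} (h0 : leafE n HX T E 0 0 = true)
    (h : ∀ i : ℕ, i < n → radiusChunkE n HZ HX T E b i = true) :
    (tableDecoder n HZ.length T).CorrectsUpTo
      (CSSCode.ofMatrices (Census.rowMatrix n HX) (Census.rowMatrix n HZ) hcomm).xSyndrome
      ((CSSCode.ofMatrices (Census.rowMatrix n HX) (Census.rowMatrix n HZ) hcomm).rowSpX :
        Set (Fin n → ZMod 2)) hammingNorm (b + 1) :=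
  fun e he => residual_mem_of_reachesE (reachesE_of_chunks h0 h) e he

/-- **Route E, chunked, `Z`-sector** (rows exchanged). -/
theorem correctsUpToZ_of_radiusChunksE {n : ℕ} {HX HZ : List ℕ}
    (hcomm : Census.rowMatrix n HX * (Census.rowMatrix n HZ)ᵀ = 0) {T : List (ℕ × ℕ)}
    {E : List (ℕ × List ℕ)} {b : ℕ} (h0 : leafE n HZ T E 0 0 = true)
    (h : ∀ i : ℕ, i < n → radiusChunkE n HX HZ T E b i = true) :
    (tableDecoder n HX.length T).CorrectsUpTo
      (CSSCode.ofMatrices (Census.rowMatrix n HX) (Census.rowMatrix n HZ) hcomm).zSyndrome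
      ((CSSCode.ofMatrices (Census.rowMatrix n HX) (Census.rowMatrix n HZ) hcomm).rowSpZ :
        Set (Fin n → ZMod 2)) hammingNorm (b + 1) :=
  correctsUpToX_of_radiusChunksE
    (CSSCode.ofMatrices (Census.rowMatrix n HX) (Census.rowMatrix n HZ) hcomm).swap.comm h0 h

/-! ## Route I: the table answer is the error itself -/

/-- Leaf test of route I at (error word `v`, syndrome word `s`): `T(s) = v`. -/
def leafI (T : List (ℕ × ℕ)) (v s : ℕ) : Bool := (T.lookup s).getD 0 == v

/-- **Route-I radius check** (identity residual): every word of weight `≤ t` is returned verbatim by the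
table on its own `Hsyn`-syndrome — the nondegenerate regime, where the weight-`≤ t` error with a given
syndrome is unique. No residual certificates and no distance are needed. -/
def checkRadiusI (n : ℕ) (Hsyn : List ℕ) (T : List (ℕ × ℕ)) (t : ℕ) : Bool :=
  Census.scan (leafI T) (Census.posList n Hsyn) t 0 0

/-- Chunk `i` of the route-I replay with total budget `b + 1`. -/
def radiusChunkI (n : ℕ) (Hsyn : List ℕ) (T : List (ℕ × ℕ)) (b i : ℕ) : Bool :=
  Census.scan (leafI T) ((Census.posList n Hsyn).drop (i + 1)) b (2 ^ i) (Census.colMask Hsyn i)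

/-- **Route I from any complete replay**: the residual of every error of weight `≤ t` is `0`. -/
theorem residual_eq_zero_of_reachesI {n : ℕ} {Hsyn : List ℕ} {T : List (ℕ × ℕ)} {t : ℕ}
    (h : Census.Reaches (leafI T) (Census.posList n Hsyn) t 0 0) (e : Fin n → ZMod 2)
    (he : hammingNorm e ≤ t) :
    tableDecoder n Hsyn.length T (Census.rowMatrix n Hsyn *ᵥ e) + e = 0 := by
  have hS := h (Census.suppList n Hsyn e) (Census.suppList_sublist n Hsyn e)
    (by rw [Census.length_suppList]; exact he)
  rw [Nat.zero_xor, Nat.zero_xor, leafI, beq_iff_eq] at hS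
  rw [tableDecoder_mulVec, hS, Census.ofBits_xorFst_suppList]
  funext i
  exact CharTwo.add_self_eq_zero _

/-- **Assembling the route-I chunks.** -/
theorem reachesI_of_chunks {n : ℕ} {Hsyn : List ℕ} {T : List (ℕ × ℕ)} {b : ℕ}
    (h0 : leafI T 0 0 = true) (h : ∀ i : ℕ, i < n → radiusChunkI n Hsyn T b i = true) :
    Census.Reaches (leafI T) (Census.posList n Hsyn) (b + 1) 0 0 := by
  refine Census.reaches_of_chunks _ b 0 0 h0 fun i hi => ?_
  have hin : i < n := by simpa [Census.posList] using hi
  have hget : (Census.posList n Hsyn)[i] = (2 ^ i, Census.colMask Hsyn i) := by simp [Census.posList]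
  rw [hget, Nat.zero_xor, Nat.zero_xor]
  exact Census.reaches_of_scan (h i hin)

/-- Route I, `X`-sector, from a complete replay: the table decoder corrects every `X`-error of weight
`≤ t` (residual `0 ∈ rs H^X`). -/
theorem correctsUpToX_of_reachesI {n : ℕ} {HX HZ : List ℕ}
    (hcomm : Census.rowMatrix n HX * (Census.rowMatrix n HZ)ᵀ = 0) {T : List (ℕ × ℕ)} {t : ℕ}
    (h : Census.Reaches (leafI T) (Census.posList n HZ) t 0 0) :
    (tableDecoder n HZ.length T).CorrectsUpTo
      (CSSCode.ofMatrices (Census.rowMatrix n HX) (Census.rowMatrix n HZ) hcomm).xSyndrome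
      ((CSSCode.ofMatrices (Census.rowMatrix n HX) (Census.rowMatrix n HZ) hcomm).rowSpX :
        Set (Fin n → ZMod 2)) hammingNorm t := by
  intro e he
  rw [Decoder.corrects_iff, SetLike.mem_coe, CSSCode.xSyndrome_apply]
  have h0 := residual_eq_zero_of_reachesI h e he
  rw [show (CSSCode.ofMatrices (Census.rowMatrix n HX) (Census.rowMatrix n HZ) hcomm).HZ =
      Census.rowMatrix n HZ from rfl, h0]
  exact Submodule.zero_mem _

/-- **Soundness of route I (`X`-sector), one scan.** -/
theorem correctsUpToX_of_checkRadiusI {n : ℕ} {HX HZ : List ℕ}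
    (hcomm : Census.rowMatrix n HX * (Census.rowMatrix n HZ)ᵀ = 0) {T : List (ℕ × ℕ)} {t : ℕ}
    (h : checkRadiusI n HZ T t = true) :
    (tableDecoder n HZ.length T).CorrectsUpTo
      (CSSCode.ofMatrices (Census.rowMatrix n HX) (Census.rowMatrix n HZ) hcomm).xSyndrome
      ((CSSCode.ofMatrices (Census.rowMatrix n HX) (Census.rowMatrix n HZ) hcomm).rowSpX :
        Set (Fin n → ZMod 2)) hammingNorm t :=
  correctsUpToX_of_reachesI hcomm (Census.reaches_of_scan h)

/-- **Soundness of route I (`X`-sector), chunked.** -/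
theorem correctsUpToX_of_radiusChunksI {n : ℕ} {HX HZ : List ℕ}
    (hcomm : Census.rowMatrix n HX * (Census.rowMatrix n HZ)ᵀ = 0) {T : List (ℕ × ℕ)} {b : ℕ}
    (h0 : leafI T 0 0 = true) (h : ∀ i : ℕ, i < n → radiusChunkI n HZ T b i = true) :
    (tableDecoder n HZ.length T).CorrectsUpTo
      (CSSCode.ofMatrices (Census.rowMatrix n HX) (Census.rowMatrix n HZ) hcomm).xSyndrome
      ((CSSCode.ofMatrices (Census.rowMatrix n HX) (Census.rowMatrix n HZ) hcomm).rowSpX :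
        Set (Fin n → ZMod 2)) hammingNorm (b + 1) :=
  correctsUpToX_of_reachesI hcomm (reachesI_of_chunks h0 h)

/-- **Soundness of route I (`Z`-sector), one scan** (rows exchanged). -/
theorem correctsUpToZ_of_checkRadiusI {n : ℕ} {HX HZ : List ℕ}
    (hcomm : Census.rowMatrix n HX * (Census.rowMatrix n HZ)ᵀ = 0) {T : List (ℕ × ℕ)} {t : ℕ}
    (h : checkRadiusI n HX T t = true) :
    (tableDecoder n HX.length T).CorrectsUpTo
      (CSSCode.ofMatrices (Census.rowMatrix n HX) (Census.rowMatrix n HZ) hcomm).zSyndrome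
      ((CSSCode.ofMatrices (Census.rowMatrix n HX) (Census.rowMatrix n HZ) hcomm).rowSpZ :
        Set (Fin n → ZMod 2)) hammingNorm t :=
  correctsUpToX_of_checkRadiusI
    (CSSCode.ofMatrices (Census.rowMatrix n HX) (Census.rowMatrix n HZ) hcomm).swap.comm h

/-- **Soundness of route I (`Z`-sector), chunked.** -/
theorem correctsUpToZ_of_radiusChunksI {n : ℕ} {HX HZ : List ℕ}
    (hcomm : Census.rowMatrix n HX * (Census.rowMatrix n HZ)ᵀ = 0) {T : List (ℕ × ℕ)} {b : ℕ}
    (h0 : leafI T 0 0 = true) (h : ∀ i : ℕ, i < n → radiusChunkI n HX T b i = true) :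
    (tableDecoder n HX.length T).CorrectsUpTo
      (CSSCode.ofMatrices (Census.rowMatrix n HX) (Census.rowMatrix n HZ) hcomm).zSyndrome
      ((CSSCode.ofMatrices (Census.rowMatrix n HX) (Census.rowMatrix n HZ) hcomm).rowSpZ :
        Set (Fin n → ZMod 2)) hammingNorm (b + 1) :=
  correctsUpToX_of_radiusChunksI
    (CSSCode.ofMatrices (Census.rowMatrix n HX) (Census.rowMatrix n HZ) hcomm).swap.comm h0 h

/-! ## Control: route I on the 3×3 toric code MWPM tables (`t = 1`), one scan and chunked -/

/-- Route I passes on the toric `L = 3` MWPM `X`-table (`decide`, tier KERNEL). -/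
theorem checkRadiusI_toricL3_X : checkRadiusI 18 ToricL3MWPM.HZ ToricL3MWPM.TX 1 = true := by decide

/-- Route I chunked (18 chunks of budget `0` + the empty word) passes on the same table (`decide`). -/
theorem radiusChunksI_toricL3_X :
    leafI ToricL3MWPM.TX 0 0 = true ∧ ∀ i : ℕ, i < 18 → radiusChunkI 18 ToricL3MWPM.HZ ToricL3MWPM.TX 0 i = true := by
  refine ⟨by decide, fun i hi => ?_⟩
  interval_cases i <;> decide

/-- The chunked route-I certificate gives the same kernel fact as `ToricL3MWPM.radiusX`. -/
theorem radiusX_toricL3_of_chunks :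
    (tableDecoder 18 ToricL3MWPM.HZ.length ToricL3MWPM.TX).CorrectsUpTo ToricL3MWPM.code.xSyndrome
      (ToricL3MWPM.code.rowSpX : Set (Fin 18 → ZMod 2)) hammingNorm 1 :=
  correctsUpToX_of_radiusChunksI _ radiusChunksI_toricL3_X.1 radiusChunksI_toricL3_X.2

end Summit.Ventures.QEC.Decoders
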